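/-
Copyright: the b2b-balaban T⁴-continuum CRUX team, row NE7b leaf lineage `t4-ne7b-formalise-leaf-06` (gen 162). Project licence.
-/
import Summits.QuantumFields.BalabanUV.T4Continuum.Spine.NE7b.SupEquationTower
import Summits.QuantumFields.BalabanUV.T4Continuum.Spine.NE7b.SupEquationTowerStepWeighted

/-!
# THE EQUATION-MAP TOWER OVER ℕ WITH A SECOND CURRENCY: `…SupEquationTower.tower_eq`'s recursion re-run on
# `…SupEquationTowerStepWeighted.towerStep_weighted` ⟹ ONE tower `(σ, Eq, Eq′, 𝒮, Φ)` (weights play no part in its construction) with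
# TOWER's (R) (S) (B) (C), `Φ_k` differentiable on `closedBall 0 r_k` with the chain rule `DΦ_{k+1}(w) = DΦ_k(σ_k w)∘Dσ_k(w)`, AND — for
# EVERY per-level seminorm family and letters chosen AFTER the tower — at every level the second-currency state, the fibre ∕ covariance
# letter (W1), the response letter (W2) and its two-point modulus (W3) OFF THE ORIGIN, and the composite response letter
# `p_0(DΦ_k(w) v) ≤ (∏_{j<k} K^w_j)·p_k(v)`, `K^w_j = N^w_j∕(1 − N^w_j c^w_j)` (row NE7b, node U5c; TOWER + STEPW BY NAME; [folklore];
# any Banach currencies, any seminorms; the product DISPLAYED — SECS is its value AT the origin, `…SupEquationTowerOneShotWeighted` its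
# one-constant replacement via the one-shot identification)

Cell `pub-balaban`, sub-cell `t4`, spine estimate NE7b (`T4WeightBudget.RelWeightBound`; the cell's OWN estimate — NOT PRINTED in
[Bałaban 1983–89], NOT PROVED).  Crux-route work under `Spine/NE7b/` by a row leaf (`t4-ne7b-formalise-leaf-06` gen 162) under FREEZE
(0)'s crux-prover clause (the OWNER g115's ι-3 answer, taken [NE7bLEAF06-G162-ONLINE]; W-ne7bp1-g116-1 (b)).  NOTHING of Bałaban's is
named as a Lean object, valued or asserted; no `T4Continuum/Support` leaf typed; no `def`; zero `sorry`.  Imports: this lineage's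
`…SupEquationTower` (TOWER: `lipschitzOnWith_id_one`, `prod_range_succ_K₁`) and `…SupEquationTowerStepWeighted` (STEPW).

WHY (located).  TOWER runs `towerStep` over ℕ by `Nat.rec` on the Σ-type of FIRST-currency states and exports (R) (S) (B) (C); SECS reads
the second currency AT the origin off the charts' sections, for seminorm families chosen AFTER `σ` (the OWNER's rider (i): the content
of (62)–(66) is UNIFORMITY over the weights `(μ, ρ)` for ONE background).  OFF the origin the per-level letters are SRSC's bootstrap
ones, and STEPW shows they re-enter — again for families chosen after the branch.  THIS FILE keeps that order on the whole tower: the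
recursion is TOWER's (first-currency states only; the weights do not enter the construction, so (R) holds by `rfl` and the tower is ONE
object for all weights), STEPW's after-`σ` clause is carried along the recursion as a third component of each step's specification, and
then, for any seminorm families with their letters and the level-`0` second-currency state, an induction over `k` feeds the level-`k`
second-currency state into that clause: out come (W1)–(W3) at level `k` and the state at level `k+1`.  (C) gains the differentiability of
`Φ_k` on `closedBall 0 r_k` (each `σ_j` is differentiable on the OPEN chart ball, which contains the next closed radius ball) with the
chain rule, and the composite response letter follows from (W2) by a second induction.  (W1) at level `k` is the covariance column
`C̃_k(w)` of the level-`k` interacting chart at every background in the chart ball, bounded in the level-`k` second currency by its fibre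
source.  HONEST BOOKKEEPING: `∏_{j<k} K^w_j` is DISPLAYED, each factor `≥ N^w_j`; in the model the OWNER's one-shot ∕ semigroup
identification (SOS `tower_eq_oneShot`: `Φ_k = σ₀ₖ`; C-ne7bp1-g116-2 `SupBackgroundSemigroup`) replaces it by ONE bootstrap constant of the
composite chart — the sibling `…SupEquationTowerOneShotWeighted`, not here.

WHAT IS PROVED ([folklore]; `X, K : ℕ → Type`, every `X k` a nontrivial real Banach space, every `K k` real normed):
* §1 `prod_range_succ_Kw` (the product letter's recursion in the order the chain rule produces).
* §2 **`tower_eq_weighted`** — `tower_eq`'s hypotheses VERBATIM ⟹ `∃ σ Eq Eq′ 𝒮 Φ` with TOWER's (R) (S) (B) (C) VERBATIM, PLUS in (C′):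
  `Φ_k` differentiable at every `w ∈ closedBall 0 r_k` and the chain rule `fderiv (Φ (k+1)) w = fderiv (Φ k) (σ k w) ∘ fderiv (σ k) w` on
  `closedBall 0 r_{k+1}`, PLUS (W) — for EVERY choice, AFTER the tower, of seminorm families `p_k` on `X k`, `q_k` on `K k`, nonnegative
  `N^w, B^w, M^w, C^w_P, C^w_Q : ℕ → ℝ`, `c^w` with `C^w_{P_k} M^w_k r_k ≤ c^w_k`, `N^w_k c^w_k < 1`, charts' ∕ blockings' seminorm letters, the
  two recursion inequalities, and the level-`0` second-currency state of `Eq₀′` — AT EVERY LEVEL `k`: the second-currency state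
  `p_k(Eq′_k x u) ≤ B^w_k p_k u`, `p_k((Eq′_k x − Eq′_k x′)u) ≤ M^w_k‖x − x′‖p_k u`; (W1) `Q_k u = 0 → p_k u ≤ K^w_k q_k(P_k(Eq′_k(σ_k w) u))` on
  the closed chart ball; (W2) `p_k(Dσ_k(w) v) ≤ K^w_k p_{k+1} v` and (W3) the two-point modulus on the open chart ball; and
  **`p_0(fderiv (Φ k) w v) ≤ (∏_{j<k} K^w_j)·p_k v`** on `closedBall 0 r_k`.
* §3 toy (`example`).

NOT HERE (honest): the `ℓ^∞(ℤ^d)` instance and the letters BY VALUE; any control of the products ∕ recursions; the composite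
covariance column in closed form (sibling SOSW); (A3) ∕ (A1c); NC-NE7b-α UNRULED; anything of Bałaban's.  BY-NAME EFFECT ON THE WALL:
NONE.  NE7b NOT PRINTED ∕ NOT PROVED; spine PROVED 0∕9; rung (B)+1 on a FINITE torus — NOT infinite volume, NOT the mass gap, NOT Clay.
HONEST DEPENDENCY: continuum YM on T⁴ ⇐ BetaPertH ∧ nine spine estimates (0∕9 proved); BetaPertH ⇐ (D1) ∧ (D4) ∧ CAP+tail;
G-an2-4 gates asym, D1 and NE2∕3∕4.
-/

set_option autoImplicit false

noncomputable section

namespace Summit.QuantumFields.BalabanUV.T4Continuum.NE7b.SupEquationTowerWeighted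

open Set Metric Function
open scoped NNReal
open Summit.QuantumFields.BalabanUV.T4Continuum.NE7b

/-! ## §1. The product letter's recursion -/

/-- `∏_{j<k+1} K^w_j = (∏_{j<k} K^w_j) · K^w_k`. [folklore] -/
theorem prod_range_succ_Kw (Nw cw : ℕ → ℝ) (k : ℕ) :
    (∏ j ∈ Finset.range (k + 1), Nw j / (1 - Nw j * cw j)) =
      (∏ j ∈ Finset.range k, Nw j / (1 - Nw j * cw j)) * (Nw k / (1 - Nw k * cw k)) :=
  Finset.prod_range_succ _ k

/-! ## §2. THE TOWER WITH A SECOND CURRENCY -/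

variable {X : ℕ → Type*} {K : ℕ → Type*} [∀ k, NormedAddCommGroup (X k)] [∀ k, NormedSpace ℝ (X k)]
  [∀ k, NormedAddCommGroup (K k)] [∀ k, NormedSpace ℝ (K k)]

/-- **THE EQUATION-MAP TOWER OVER ℕ WITH A SECOND CURRENCY.**  `…SupEquationTower.tower_eq`'s data verbatim ⟹ ONE tower with TOWER's
(R) (S) (B) (C), the differentiability of every `Φ_k` on `closedBall 0 r_k` with the chain rule, and — for every per-level seminorm
family with its letters, recursions and level-`0` second-currency state, chosen AFTER the tower — at every level the second-currency
state, SRSC's (W1)–(W3), and the composite response letter `p_0(DΦ_k(w) v) ≤ (∏_{j<k} K^w_j)·p_k v` on `closedBall 0 r_k`. [folklore] -/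
theorem tower_eq_weighted [∀ k, CompleteSpace (X k)] [∀ k, Nontrivial (X k)]
    (Q : ∀ k, X k →L[ℝ] X (k + 1)) (Lp : ∀ k, X (k + 1) →L[ℝ] X k) (P : ∀ k, X k →L[ℝ] K k) (ι : ∀ k, K k →L[ℝ] X k)
    (hPι : ∀ k h, ι k (P k h) = h - Lp k (Q k h)) {CP : ℕ → ℝ} (hCP : ∀ k, ‖P k‖ ≤ CP k)
    (𝒬 : ∀ k, X 0 →L[ℝ] X k) (h𝒬0 : 𝒬 0 = ContinuousLinearMap.id ℝ (X 0)) (h𝒬 : ∀ k, 𝒬 (k + 1) = (Q k).comp (𝒬 k))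
    {Eq₀ : X 0 → X 0} {Eq₀' : X 0 → X 0 →L[ℝ] X 0} (hE0 : Eq₀ 0 = 0)
    {r B M : ℕ → ℝ} (hr0 : ∀ k, 0 ≤ r k) (hM0 : ∀ k, 0 ≤ M k)
    (hE : ∀ x ∈ closedBall (0 : X 0) (r 0), HasFDerivAt Eq₀ (Eq₀' x) x)
    (hB : ∀ x ∈ closedBall (0 : X 0) (r 0), ‖Eq₀' x‖ ≤ B 0)
    (hM : ∀ x ∈ closedBall (0 : X 0) (r 0), ∀ x' ∈ closedBall (0 : X 0) (r 0), ‖Eq₀' x - Eq₀' x'‖ ≤ M 0 * ‖x - x'‖)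
    (T : ∀ k, X k ≃L[ℝ] X (k + 1) × K k) {N c : ℕ → ℝ≥0}
    (hT : ∀ k (𝒮 : X k →L[ℝ] X 0), (𝒬 k).comp 𝒮 = ContinuousLinearMap.id ℝ (X k) →
      (∀ j, j < k → ∀ h, P j (𝒬 j (Eq₀' 0 (𝒮 h))) = 0) → ∀ h, T k h = (Q k h, P k (𝒬 k (Eq₀' 0 (𝒮 h)))))
    (hN : ∀ k (y : X (k + 1) × K k), ‖(T k).symm y‖ ≤ N k * ‖y‖) (hcN : ∀ k, c k < (N k)⁻¹)
    (hc : ∀ k, CP k * M k * r k ≤ (c k : ℝ)) (hr : ∀ k, r (k + 1) < ((N k : ℝ)⁻¹ - c k) * r k)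
    (hBs : ∀ k, ‖Q k‖ * B k * ((N k : ℝ)⁻¹ - c k)⁻¹ ≤ B (k + 1))
    (hMs : ∀ k, ‖Q k‖ * (M k * ((N k : ℝ)⁻¹ - c k)⁻¹ * ((N k : ℝ)⁻¹ - c k)⁻¹ +
      B k * ((((N k : ℝ)⁻¹ - c k)⁻¹) ^ 2 * (CP k * M k) * ((N k : ℝ)⁻¹ - c k)⁻¹)) ≤ M (k + 1)) :
    ∃ (σ : ∀ k, X (k + 1) → X k) (Eq : ∀ k, X k → X k) (Eq' : ∀ k, X k → X k →L[ℝ] X k) (𝒮 : ∀ k, X k →L[ℝ] X 0)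
      (Φ : ∀ k, X k → X 0),
      -- (R) the recursion equations
      Eq 0 = Eq₀ ∧ Eq' 0 = Eq₀' ∧ 𝒮 0 = ContinuousLinearMap.id ℝ (X 0) ∧ Φ 0 = id ∧
      (∀ k, Eq (k + 1) = fun w => Q k (Eq k (σ k w))) ∧
      (∀ k, Eq' (k + 1) = fun w => (Q k).comp ((Eq' k (σ k w)).comp (fderiv ℝ (σ k) w))) ∧
      (∀ k, 𝒮 (k + 1) = (𝒮 k).comp (fderiv ℝ (σ k) 0)) ∧
      (∀ k, Φ (k + 1) = Φ k ∘ σ k) ∧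
      -- (S) the state letters at every level
      (∀ k, Eq k 0 = 0 ∧ (∀ x ∈ closedBall (0 : X k) (r k), HasFDerivAt (Eq k) (Eq' k x) x) ∧
        (∀ x ∈ closedBall (0 : X k) (r k), ‖Eq' k x‖ ≤ B k) ∧
        (∀ x ∈ closedBall (0 : X k) (r k), ∀ x' ∈ closedBall (0 : X k) (r k), ‖Eq' k x - Eq' k x'‖ ≤ M k * ‖x - x'‖) ∧
        (𝒬 k).comp (𝒮 k) = ContinuousLinearMap.id ℝ (X k) ∧
        (∀ j, j < k → ∀ h, P j (𝒬 j (Eq₀' 0 (𝒮 k h))) = 0) ∧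
        Eq' k 0 = (𝒬 k).comp ((Eq₀' 0).comp (𝒮 k))) ∧
      -- (B) the branch letters at every level
      (∀ k, σ k 0 = 0 ∧
        (∀ w ∈ closedBall (0 : X (k + 1)) (((N k : ℝ)⁻¹ - c k) * r k),
          σ k w ∈ closedBall (0 : X k) (r k) ∧ Q k (σ k w) = w ∧ P k (Eq k (σ k w)) = 0 ∧ Eq k (σ k w) = Lp k (Eq (k + 1) w)) ∧
        LipschitzOnWith ((N k)⁻¹ - c k)⁻¹ (σ k) (closedBall (0 : X (k + 1)) (((N k : ℝ)⁻¹ - c k) * r k)) ∧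
        (∀ x ∈ closedBall (0 : X k) (r k), P k (Eq k x) = 0 → σ k (Q k x) = x) ∧
        (∀ w ∈ ball (0 : X (k + 1)) (((N k : ℝ)⁻¹ - c k) * r k), DifferentiableAt ℝ (σ k) w ∧
          ‖fderiv ℝ (σ k) w‖ ≤ ((N k : ℝ)⁻¹ - c k)⁻¹ ∧ (Q k).comp (fderiv ℝ (σ k) w) = ContinuousLinearMap.id ℝ (X (k + 1)))) ∧
      -- (C) the composite letters at every level
      (∀ k, Φ k 0 = 0 ∧ (∀ w ∈ closedBall (0 : X k) (r k), Φ k w ∈ closedBall (0 : X 0) (r 0)) ∧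
        (∀ w ∈ closedBall (0 : X k) (r k), 𝒬 k (Φ k w) = w) ∧
        LipschitzOnWith (∏ j ∈ Finset.range k, ((N j)⁻¹ - c j)⁻¹) (Φ k) (closedBall (0 : X k) (r k)) ∧
        (∀ w ∈ closedBall (0 : X k) (r k), Eq k w = 0 → Eq₀ (Φ k w) = 0)) ∧
      -- (C′) differentiability of the composite transport and the chain rule along the tower
      (∀ k, ∀ w ∈ closedBall (0 : X k) (r k), DifferentiableAt ℝ (Φ k) w) ∧
      (∀ k, ∀ w ∈ closedBall (0 : X (k + 1)) (r (k + 1)),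
        fderiv ℝ (Φ (k + 1)) w = (fderiv ℝ (Φ k) (σ k w)).comp (fderiv ℝ (σ k) w)) ∧
      -- (W) THE SECOND CURRENCY — for EVERY choice of per-level seminorm families, letters, recursions and level-0 second-currency
      -- state, chosen AFTER the tower (one tower for all admissible weights), AT EVERY LEVEL `k`: the second-currency state, (W1) the
      -- fibre ∕ covariance letter on the closed chart ball, (W2) the response letter and (W3) its two-point modulus on the open chart ball,
      -- and the composite response letter `p_0(DΦ_k(w) v) ≤ (∏_{j<k} K^w_j)·p_k v` on `closedBall 0 r_k`
      (∀ (p : ∀ j, Seminorm ℝ (X j)) (q : ∀ j, Seminorm ℝ (K j)) (Nw cw Bw Mw CPw CQw : ℕ → ℝ),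
        (∀ j, 0 ≤ Nw j) → (∀ j, 0 ≤ Bw j) → (∀ j, 0 ≤ Mw j) → (∀ j, 0 ≤ CPw j) → (∀ j, 0 ≤ CQw j) →
        (∀ j (y₁ : X (j + 1)) (y₂ : K j), p j ((T j).symm (y₁, y₂)) ≤ Nw j * (p (j + 1) y₁ + q j y₂)) →
        (∀ j h, q j (P j h) ≤ CPw j * p j h) → (∀ j h, p (j + 1) (Q j h) ≤ CQw j * p j h) →
        (∀ j, CPw j * Mw j * r j ≤ cw j) → (∀ j, Nw j * cw j < 1) →
        (∀ j, CQw j * Bw j * (Nw j / (1 - Nw j * cw j)) ≤ Bw (j + 1)) →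
        (∀ j, CQw j * (Mw j * ((N j : ℝ)⁻¹ - c j)⁻¹ * (Nw j / (1 - Nw j * cw j)) +
          Bw j * (Nw j / (1 - Nw j * cw j) * CPw j * Mw j * ((N j : ℝ)⁻¹ - c j)⁻¹ * (Nw j / (1 - Nw j * cw j)))) ≤ Mw (j + 1)) →
        (∀ x ∈ closedBall (0 : X 0) (r 0), ∀ u, p 0 (Eq₀' x u) ≤ Bw 0 * p 0 u) →
        (∀ x ∈ closedBall (0 : X 0) (r 0), ∀ x' ∈ closedBall (0 : X 0) (r 0), ∀ u,
          p 0 ((Eq₀' x - Eq₀' x') u) ≤ Mw 0 * ‖x - x'‖ * p 0 u) →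
        ∀ k,
          -- the second-currency state at level `k`
          (∀ x ∈ closedBall (0 : X k) (r k), ∀ u, p k (Eq' k x u) ≤ Bw k * p k u) ∧
          (∀ x ∈ closedBall (0 : X k) (r k), ∀ x' ∈ closedBall (0 : X k) (r k), ∀ u,
            p k ((Eq' k x - Eq' k x') u) ≤ Mw k * ‖x - x'‖ * p k u) ∧
          -- (W1) the fibre ∕ covariance letter at every background in the closed chart ball
          (∀ w ∈ closedBall (0 : X (k + 1)) (((N k : ℝ)⁻¹ - c k) * r k), ∀ u, Q k u = 0 →
            p k u ≤ Nw k / (1 - Nw k * cw k) * q k (P k (Eq' k (σ k w) u))) ∧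
          -- (W2) the response letter off the origin
          (∀ w ∈ ball (0 : X (k + 1)) (((N k : ℝ)⁻¹ - c k) * r k), ∀ v,
            p k (fderiv ℝ (σ k) w v) ≤ Nw k / (1 - Nw k * cw k) * p (k + 1) v) ∧
          -- (W3) the response's second-currency two-point modulus
          (∀ w ∈ ball (0 : X (k + 1)) (((N k : ℝ)⁻¹ - c k) * r k), ∀ w' ∈ ball (0 : X (k + 1)) (((N k : ℝ)⁻¹ - c k) * r k), ∀ v,
            p k ((fderiv ℝ (σ k) w - fderiv ℝ (σ k) w') v) ≤
              Nw k / (1 - Nw k * cw k) * CPw k * Mw k * ((N k : ℝ)⁻¹ - c k)⁻¹ * (Nw k / (1 - Nw k * cw k)) * ‖w - w'‖ *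
                p (k + 1) v) ∧
          -- the composite response letter OFF the origin
          (∀ w ∈ closedBall (0 : X k) (r k), ∀ v,
            p 0 (fderiv ℝ (Φ k) w v) ≤ (∏ j ∈ Finset.range k, Nw j / (1 - Nw j * cw j)) * p k v)) := by
  -- the state predicate at level `k` (first currency only: the weights do not enter the construction) and the Σ-type of states
  let Inv : (k : ℕ) → (X k → X k) → (X k → X k →L[ℝ] X k) → (X k →L[ℝ] X 0) → Prop := fun k E E' S =>
    E 0 = 0 ∧ (∀ x ∈ closedBall (0 : X k) (r k), HasFDerivAt E (E' x) x) ∧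
      (∀ x ∈ closedBall (0 : X k) (r k), ‖E' x‖ ≤ B k) ∧
      (∀ x ∈ closedBall (0 : X k) (r k), ∀ x' ∈ closedBall (0 : X k) (r k), ‖E' x - E' x'‖ ≤ M k * ‖x - x'‖) ∧
      (𝒬 k).comp S = ContinuousLinearMap.id ℝ (X k) ∧
      (∀ j, j < k → ∀ h, P j (𝒬 j (Eq₀' 0 (S h))) = 0) ∧
      E' 0 = (𝒬 k).comp ((Eq₀' 0).comp S)
  let St : (k : ℕ) → Type _ := fun k =>
    {s : (X k → X k) × (X k → X k →L[ℝ] X k) × (X k →L[ℝ] X 0) // Inv k s.1 s.2.1 s.2.2}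
  -- the branch letters at level `k`
  let Br : (k : ℕ) → (X k → X k) → (X (k + 1) → X k) → Prop := fun k E s =>
    s 0 = 0 ∧
      (∀ w ∈ closedBall (0 : X (k + 1)) (((N k : ℝ)⁻¹ - c k) * r k),
        s w ∈ closedBall (0 : X k) (r k) ∧ Q k (s w) = w ∧ P k (E (s w)) = 0 ∧ E (s w) = Lp k (Q k (E (s w)))) ∧
      LipschitzOnWith ((N k)⁻¹ - c k)⁻¹ s (closedBall (0 : X (k + 1)) (((N k : ℝ)⁻¹ - c k) * r k)) ∧
      (∀ x ∈ closedBall (0 : X k) (r k), P k (E x) = 0 → s (Q k x) = x) ∧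
      (∀ w ∈ ball (0 : X (k + 1)) (((N k : ℝ)⁻¹ - c k) * r k), DifferentiableAt ℝ s w ∧
        ‖fderiv ℝ s w‖ ≤ ((N k : ℝ)⁻¹ - c k)⁻¹ ∧ (Q k).comp (fderiv ℝ s w) = ContinuousLinearMap.id ℝ (X (k + 1))) ∧
      (∀ w ∈ closedBall (0 : X (k + 1)) (((N k : ℝ)⁻¹ - c k) * r k), Q k (E (s w)) = 0 → E (s w) = 0)
  -- STEPW's after-`σ` second-currency clause at level `k`, for the state `(E, E′)` and the branch `s`
  let Wcl : (k : ℕ) → (X k → X k →L[ℝ] X k) → (X (k + 1) → X k) → Prop := fun k E' s =>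
    ∀ (p : ∀ j, Seminorm ℝ (X j)) (q : ∀ j, Seminorm ℝ (K j)) (Nw cw Bw Mw CPw CQw : ℕ → ℝ),
      (∀ j, 0 ≤ Nw j) → (∀ j, 0 ≤ Bw j) → (∀ j, 0 ≤ Mw j) → (∀ j, 0 ≤ CPw j) → (∀ j, 0 ≤ CQw j) →
      (∀ j (y₁ : X (j + 1)) (y₂ : K j), p j ((T j).symm (y₁, y₂)) ≤ Nw j * (p (j + 1) y₁ + q j y₂)) →
      (∀ j h, q j (P j h) ≤ CPw j * p j h) → (∀ j h, p (j + 1) (Q j h) ≤ CQw j * p j h) →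
      (∀ j, CPw j * Mw j * r j ≤ cw j) → (∀ j, Nw j * cw j < 1) →
      (∀ j, CQw j * Bw j * (Nw j / (1 - Nw j * cw j)) ≤ Bw (j + 1)) →
      (∀ j, CQw j * (Mw j * ((N j : ℝ)⁻¹ - c j)⁻¹ * (Nw j / (1 - Nw j * cw j)) +
        Bw j * (Nw j / (1 - Nw j * cw j) * CPw j * Mw j * ((N j : ℝ)⁻¹ - c j)⁻¹ * (Nw j / (1 - Nw j * cw j)))) ≤ Mw (j + 1)) →
      (∀ x ∈ closedBall (0 : X k) (r k), ∀ u, p k (E' x u) ≤ Bw k * p k u) →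
      (∀ x ∈ closedBall (0 : X k) (r k), ∀ x' ∈ closedBall (0 : X k) (r k), ∀ u,
        p k ((E' x - E' x') u) ≤ Mw k * ‖x - x'‖ * p k u) →
      (∀ w ∈ closedBall (0 : X (k + 1)) (((N k : ℝ)⁻¹ - c k) * r k), ∀ u, Q k u = 0 →
        p k u ≤ Nw k / (1 - Nw k * cw k) * q k (P k (E' (s w) u))) ∧
      (∀ w ∈ ball (0 : X (k + 1)) (((N k : ℝ)⁻¹ - c k) * r k), ∀ v,
        p k (fderiv ℝ s w v) ≤ Nw k / (1 - Nw k * cw k) * p (k + 1) v) ∧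
      (∀ w ∈ ball (0 : X (k + 1)) (((N k : ℝ)⁻¹ - c k) * r k), ∀ w' ∈ ball (0 : X (k + 1)) (((N k : ℝ)⁻¹ - c k) * r k), ∀ v,
        p k ((fderiv ℝ s w - fderiv ℝ s w') v) ≤
          Nw k / (1 - Nw k * cw k) * CPw k * Mw k * ((N k : ℝ)⁻¹ - c k)⁻¹ * (Nw k / (1 - Nw k * cw k)) * ‖w - w'‖ *
            p (k + 1) v) ∧
      (∀ w ∈ closedBall (0 : X (k + 1)) (r (k + 1)), ∀ v,
        p (k + 1) ((Q k).comp ((E' (s w)).comp (fderiv ℝ s w)) v) ≤ Bw (k + 1) * p (k + 1) v) ∧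
      (∀ w ∈ closedBall (0 : X (k + 1)) (r (k + 1)), ∀ w' ∈ closedBall (0 : X (k + 1)) (r (k + 1)), ∀ v,
        p (k + 1) (((Q k).comp ((E' (s w)).comp (fderiv ℝ s w)) - (Q k).comp ((E' (s w')).comp (fderiv ℝ s w'))) v) ≤
          Mw (k + 1) * ‖w - w'‖ * p (k + 1) v)
  -- the re-entrant step (`…SupEquationTowerStepWeighted.towerStep_weighted` BY NAME)
  have step : ∀ k (s : St k), ∃ σ : X (k + 1) → X k, Br k s.1.1 σ ∧
      Inv (k + 1) (fun w => Q k (s.1.1 (σ w))) (fun w => (Q k).comp ((s.1.2.1 (σ w)).comp (fderiv ℝ σ w)))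
        (s.1.2.2.comp (fderiv ℝ σ 0)) ∧ Wcl k s.1.2.1 σ := by
    intro k s
    obtain ⟨h1, h2, h3, h4, h5, h6, h7⟩ := s.2
    obtain ⟨σ, hσ0, ha, hlip, huniq, hb, hd, n1, n2, n3, n4, n5, n6, n7, hW⟩ :=
      SupEquationTowerStepWeighted.towerStep_weighted Q Lp P ι hPι hCP 𝒬 h𝒬 (Eq₀' 0) hr0 hM0 T hT hN hcN hc hr hBs hMs k h1 h2
        h3 h4 h5 h6 h7
    exact ⟨σ, ⟨hσ0, ha, hlip, huniq, hb, hd⟩, ⟨n1, n2, n3, n4, n5, n6, n7⟩, hW⟩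
  -- the initial state
  have inv0 : Inv 0 Eq₀ Eq₀' (ContinuousLinearMap.id ℝ (X 0)) := by
    refine ⟨hE0, hE, hB, hM, by rw [h𝒬0]; rfl, fun j hj => absurd hj (Nat.not_lt_zero j), ?_⟩
    rw [h𝒬0]; rfl
  -- the recursion over ℕ on the Σ-type of states (weights absent)
  let st : (k : ℕ) → St k := fun k =>
    Nat.rec (motive := fun k => St k) ⟨(Eq₀, Eq₀', ContinuousLinearMap.id ℝ (X 0)), inv0⟩
      (fun k s => ⟨(fun w => Q k (s.1.1 ((step k s).choose w)),
        fun w => (Q k).comp ((s.1.2.1 ((step k s).choose w)).comp (fderiv ℝ (step k s).choose w)),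
        s.1.2.2.comp (fderiv ℝ (step k s).choose 0)), (step k s).choose_spec.2.1⟩) k
  let σ : ∀ k, X (k + 1) → X k := fun k => (step k (st k)).choose
  let Φ : ∀ k, X k → X 0 := fun k => Nat.rec (motive := fun k => X k → X 0) id (fun k f => f ∘ σ k) k
  have hBr : ∀ k, Br k (st k).1.1 (σ k) := fun k => (step k (st k)).choose_spec.1
  have hWcl : ∀ k, Wcl k (st k).1.2.1 (σ k) := fun k => (step k (st k)).choose_spec.2.2
  have hEs : ∀ k w, (st (k + 1)).1.1 w = Q k ((st k).1.1 (σ k w)) := fun _ _ => rfl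
  have hE's : ∀ k w, (st (k + 1)).1.2.1 w = (Q k).comp (((st k).1.2.1 (σ k w)).comp (fderiv ℝ (σ k) w)) := fun _ _ => rfl
  have hΦs : ∀ k w, Φ (k + 1) w = Φ k (σ k w) := fun _ _ => rfl
  have hΦs' : ∀ k, Φ (k + 1) = Φ k ∘ σ k := fun _ => rfl
  -- the next radius sits inside the closed and the open chart balls
  have hsub : ∀ k, closedBall (0 : X (k + 1)) (r (k + 1)) ⊆ closedBall (0 : X (k + 1)) (((N k : ℝ)⁻¹ - c k) * r k) :=
    fun k => closedBall_subset_closedBall (hr k).le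
  have hsub' : ∀ k, closedBall (0 : X (k + 1)) (r (k + 1)) ⊆ ball (0 : X (k + 1)) (((N k : ℝ)⁻¹ - c k) * r k) :=
    fun k => closedBall_subset_ball (hr k)
  have hmaps : ∀ k, MapsTo (σ k) (closedBall (0 : X (k + 1)) (r (k + 1))) (closedBall (0 : X k) (r k)) :=
    fun k w hw => ((hBr k).2.1 w (hsub k hw)).1
  -- (C) by induction, with differentiability
  have hC : ∀ k, Φ k 0 = 0 ∧ (∀ w ∈ closedBall (0 : X k) (r k), Φ k w ∈ closedBall (0 : X 0) (r 0)) ∧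
      (∀ w ∈ closedBall (0 : X k) (r k), 𝒬 k (Φ k w) = w) ∧
      LipschitzOnWith (∏ j ∈ Finset.range k, ((N j)⁻¹ - c j)⁻¹) (Φ k) (closedBall (0 : X k) (r k)) ∧
      (∀ w ∈ closedBall (0 : X k) (r k), (st k).1.1 w = 0 → Eq₀ (Φ k w) = 0) ∧
      (∀ w ∈ closedBall (0 : X k) (r k), DifferentiableAt ℝ (Φ k) w) := by
    intro k
    induction k with
    | zero =>
      refine ⟨rfl, fun w hw => hw, fun w _ => ?_, ?_, fun w _ h => h, fun w _ => differentiableAt_id⟩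
      · rw [h𝒬0]; rfl
      · rw [Finset.prod_range_zero]
        exact SupEquationTower.lipschitzOnWith_id_one _
    | succ k ih =>
      obtain ⟨ih0, ihm, ihq, ihl, ihz, ihd⟩ := ih
      obtain ⟨hσ0, ha, hlip, -, hb, hd⟩ := hBr k
      refine ⟨?_, fun w hw => ?_, fun w hw => ?_, ?_, fun w hw h => ?_, fun w hw => ?_⟩
      · rw [hΦs, hσ0, ih0]
      · rw [hΦs]; exact ihm _ (hmaps k hw)
      · rw [hΦs, h𝒬 k, ContinuousLinearMap.comp_apply, ihq _ (hmaps k hw)]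
        exact (ha w (hsub k hw)).2.1
      · rw [SupEquationTower.prod_range_succ_K₁]
        exact ihl.comp (hlip.mono (hsub k)) (hmaps k)
      · rw [hΦs]
        rw [hEs] at h
        exact ihz _ (hmaps k hw) (hd w (hsub k hw) h)
      · -- the chain rule: `Φ_{k+1} = Φ_k ∘ σ_k`, `σ_k` differentiable on the open chart ball ⊇ the next radius ball
        obtain ⟨hdσ, -, -⟩ := hb w (hsub' k hw)
        have hcomp : HasFDerivAt (Φ (k + 1)) ((fderiv ℝ (Φ k) (σ k w)).comp (fderiv ℝ (σ k) w)) w := by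
          rw [hΦs' k]
          exact (ihd _ (hmaps k hw)).hasFDerivAt.comp w hdσ.hasFDerivAt
        exact hcomp.differentiableAt
  -- the chain rule identity
  have hchain : ∀ k, ∀ w ∈ closedBall (0 : X (k + 1)) (r (k + 1)),
      fderiv ℝ (Φ (k + 1)) w = (fderiv ℝ (Φ k) (σ k w)).comp (fderiv ℝ (σ k) w) := by
    intro k w hw
    obtain ⟨hdσ, -, -⟩ := (hBr k).2.2.2.2.1 w (hsub' k hw)
    have hdΦ := (hC k).2.2.2.2.2 _ (hmaps k hw)
    have hcomp : HasFDerivAt (Φ (k + 1)) ((fderiv ℝ (Φ k) (σ k w)).comp (fderiv ℝ (σ k) w)) w := by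
      rw [hΦs' k]
      exact hdΦ.hasFDerivAt.comp w hdσ.hasFDerivAt
    exact hcomp.fderiv
  refine ⟨σ, fun k => (st k).1.1, fun k => (st k).1.2.1, fun k => (st k).1.2.2, Φ, rfl, rfl, rfl, rfl,
    fun k => rfl, fun k => rfl, fun k => rfl, fun k => rfl, fun k => (st k).2, fun k => ?_,
    fun k => ⟨(hC k).1, (hC k).2.1, (hC k).2.2.1, (hC k).2.2.2.1, (hC k).2.2.2.2.1⟩, fun k => (hC k).2.2.2.2.2, hchain, ?_⟩
  · -- (B): the branch letters, the lift identity read in tower form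
    obtain ⟨hσ0, ha, hlip, huniq, hb, -⟩ := hBr k
    exact ⟨hσ0, fun w hw => ha w hw, hlip, huniq, hb⟩
  · -- (W): the second currency, AFTER the tower, for every admissible family
    intro p q Nw cw Bw Mw CPw CQw hNw0 hBw0 hMw0 hCPw0 hCQw0 hTw hCPw hCQw hcw hsmallw hBws hMws hBw hMw
    -- the second-currency state propagates along the recursion
    have hWS : ∀ k, (∀ x ∈ closedBall (0 : X k) (r k), ∀ u, p k ((st k).1.2.1 x u) ≤ Bw k * p k u) ∧
        (∀ x ∈ closedBall (0 : X k) (r k), ∀ x' ∈ closedBall (0 : X k) (r k), ∀ u,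
          p k (((st k).1.2.1 x - (st k).1.2.1 x') u) ≤ Mw k * ‖x - x'‖ * p k u) := by
      intro k
      induction k with
      | zero => exact ⟨hBw, hMw⟩
      | succ k ih =>
        obtain ⟨-, -, -, nB, nM⟩ := hWcl k p q Nw cw Bw Mw CPw CQw hNw0 hBw0 hMw0 hCPw0 hCQw0 hTw hCPw hCQw hcw hsmallw hBws
          hMws ih.1 ih.2
        exact ⟨fun x hx u => nB x hx u, fun x hx x' hx' u => nM x hx x' hx' u⟩
    -- (W1) (W2) (W3) at every level
    have hW123 : ∀ k, (∀ w ∈ closedBall (0 : X (k + 1)) (((N k : ℝ)⁻¹ - c k) * r k), ∀ u, Q k u = 0 →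
          p k u ≤ Nw k / (1 - Nw k * cw k) * q k (P k ((st k).1.2.1 (σ k w) u))) ∧
        (∀ w ∈ ball (0 : X (k + 1)) (((N k : ℝ)⁻¹ - c k) * r k), ∀ v,
          p k (fderiv ℝ (σ k) w v) ≤ Nw k / (1 - Nw k * cw k) * p (k + 1) v) ∧
        (∀ w ∈ ball (0 : X (k + 1)) (((N k : ℝ)⁻¹ - c k) * r k), ∀ w' ∈ ball (0 : X (k + 1)) (((N k : ℝ)⁻¹ - c k) * r k), ∀ v,
          p k ((fderiv ℝ (σ k) w - fderiv ℝ (σ k) w') v) ≤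
            Nw k / (1 - Nw k * cw k) * CPw k * Mw k * ((N k : ℝ)⁻¹ - c k)⁻¹ * (Nw k / (1 - Nw k * cw k)) * ‖w - w'‖ *
              p (k + 1) v) := fun k => by
      obtain ⟨w1, w2, w3, -, -⟩ := hWcl k p q Nw cw Bw Mw CPw CQw hNw0 hBw0 hMw0 hCPw0 hCQw0 hTw hCPw hCQw hcw hsmallw hBws hMws
        (hWS k).1 (hWS k).2
      exact ⟨w1, w2, w3⟩
    -- the composite response letter by induction along the chain rule
    have hComp : ∀ k, ∀ w ∈ closedBall (0 : X k) (r k), ∀ v,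
        p 0 (fderiv ℝ (Φ k) w v) ≤ (∏ j ∈ Finset.range k, Nw j / (1 - Nw j * cw j)) * p k v := by
      intro k
      induction k with
      | zero =>
        intro w _ v
        have e : fderiv ℝ (Φ 0) w = ContinuousLinearMap.id ℝ (X 0) := fderiv_id
        rw [e, Finset.prod_range_zero, one_mul]
        exact le_rfl
      | succ k ih =>
        intro w hw v
        have hP : 0 ≤ ∏ j ∈ Finset.range k, Nw j / (1 - Nw j * cw j) :=
          Finset.prod_nonneg fun j _ => SupResponseSecondCurrency.Kw_nonneg (hNw0 j) (hsmallw j)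
        rw [hchain k w hw, ContinuousLinearMap.comp_apply, prod_range_succ_Kw]
        calc p 0 (fderiv ℝ (Φ k) (σ k w) (fderiv ℝ (σ k) w v))
            ≤ (∏ j ∈ Finset.range k, Nw j / (1 - Nw j * cw j)) * p k (fderiv ℝ (σ k) w v) := ih _ (hmaps k hw) _
          _ ≤ (∏ j ∈ Finset.range k, Nw j / (1 - Nw j * cw j)) * (Nw k / (1 - Nw k * cw k) * p (k + 1) v) :=
              mul_le_mul_of_nonneg_left ((hW123 k).2.1 w (hsub' k hw) v) hP
          _ = (∏ j ∈ Finset.range k, Nw j / (1 - Nw j * cw j)) * (Nw k / (1 - Nw k * cw k)) * p (k + 1) v := by ring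
    exact fun k => ⟨(hWS k).1, (hWS k).2, (hW123 k).1, (hW123 k).2.1, (hW123 k).2.2, hComp k⟩

/-! ## §3. Toy -/

/-- Toy: the composite response letter after two levels with `K^w_0 = K^w_1 = 4` is `16` — the product is DISPLAYED; in the model the
one-shot identification replaces it by one bootstrap constant. -/
example : (2 : ℝ) / (1 - 2 * (1 / 4)) * (2 / (1 - 2 * (1 / 4))) = 16 := by norm_num

end Summit.QuantumFields.BalabanUV.T4Continuum.NE7b.SupEquationTowerWeighted

end
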